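import Literature.MathematicalPhysics.QuantumFieldTheory.Balaban1983to89.B7SectEFLinearisationRec
import Literature.MathematicalPhysics.QuantumFieldTheory.Balaban1983to89.B8Ineq172ConcreteRec
import Literature.MathematicalPhysics.QuantumFieldTheory.Balaban1983to89.B8Eq1115Concrete

/-!
# `Balaban1983to89.B8Eq1115ConcreteRec` — RECORD TWIN of `B8Eq1115Concrete` §1 ([Balaban1985RegularSpaces] proof of Theorem 4 ∕ Sect. E pp. 89–90, 95–96: LOCALITY of
# `ũ′ᵐ` (178)∕(179) and of the linear averaging `Q′_m` (211)–(213) of [3] ON THE BLOCK TOWER) for the SYMMETRISED CENTRED block averaging (0.4) of [Balaban1987RG1]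

statement-level skeleton of published theorems with citation tags; proofs where landed; nothing here is a claim about the Yang–Mills mass gap

T. Bałaban, *Spaces of regular gauge field configurations on a lattice and gauge fixing conditions*, Commun. Math. Phys. **99** (1985) 75–102
`[Balaban1985RegularSpaces]` ("[6]"): (1.77) p. 90, (1.115) p. 96; T. Bałaban, *Averaging operations for lattice gauge theories*, Commun. Math. Phys. **98** (1985) 17–51
`[Balaban1985Averaging]` ("[3]"): p. 24, (78) p. 30, (178)–(179) p. 45, (211)–(213) p. 50; T. Bałaban, *Renormalization group approach to lattice gauge field theories. I*,
Commun. Math. Phys. **109** (1987) 249–301 `[Balaban1987RG1]` ("[I]"): (0.3)–(0.4) pp. 252–253, pp. 253–254.  STATUS: published, refereed.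

CITATION HEADER (lean-in-tree rule).  Cell `pub-ymgap`, base `pub-ymgap-dag-n05-c` g26 — N05-REC stage 2 (director-ym №254∕№255∕№265), item R5, LEAD PEN dag-n05-e
(inventory `N05-REC-INVENTORY.md` e50db04501ab292d §R5 row `B8Eq1115Concrete`: A `utilG_congr_tower R0avg_congr_tower lamAvgG_congr_tower`).  WHAT IS REPRODUCED =
✓`B8Eq1115Concrete` §1 under the cell's TOKEN RULE over dag-n05-d's CENTRED towers (`B8Ineq130Rec.{tlo, thi, block_mem, smul_mem}`, odd `L = 2s+1`), dag-n05-e's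
R0b∕R1 twins (`avgIterZ`, `R0avgZ`, `uavgZ`, `utilGZ(_zero,_succ)`, `vtilGZ`, `lamAvgGZ(_zero,_succ)`, `rlamZ`, `savgZ_congr`) and this seat's `B8Ineq172ConcreteRec`
(`hol_block_congr`, `uavgZ_congr_tower`); proofs verbatim.  Kind «kernel-checked proof», theorems only; no `def`, no `instance`, no `notation`, no existing module modified.
`--supports stmt-QuantumFields-20541` (K0⁷-keyed, COUNT-NEUTRAL).

HONEST SCOPE: locality bookkeeping; NO inequality of [3]∕[6]∕[I]; the engine's §2–§3 (the clamped `λ ∘ π`, `eq214_local(_B8)` over (214)) are NOT twinned here (R1's (214) twin first);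
`HThm4Rec` UNDISCHARGED; caveat (C-S3-1) stands with №265's addendum («hybrid record — linearised average of record = print's (128) average composed with a covariant coarse
gauge shift Λ_j carried as a letter and absorbed into u at the Theorem-4 socket; flat-letter layer off the path modulo N2a–c»); N05 [B8] DISCHARGED OF RECORD untouched; COUNT of
record unmoved by this · K 1∕4; one finite `𝕋⁴` programme at fixed `ε`, Bałaban AS PRINTED; nothing continuum ∕ ℝ⁴ ∕ OS ∕ mass-gap ∕ Clay.  No `sorry`, no `def`.

[cite: Balaban1985RegularSpaces, (1.77) p.90, (1.115) p.96; Balaban1985Averaging, p.24, (78) p.30, (178)–(179) p.45, (211)–(213) p.50; Balaban1987RG1, (0.3)–(0.4) pp.252–253]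
-/

noncomputable section

open NormedSpace Finset

namespace Literature.MathematicalPhysics.QuantumFieldTheory.Balaban1983to89.B8Eq1115ConcreteRec

open B7Prop1Explicit B7Prop2Explicit B7Prop3Flat B7Prop1Local B7Eq92Concrete B7Eq99Concrete
open B7Eq170Flat (cj cj_apply bmean bmean_apply)
open B8Ineq130 (inBox_of_le)
open BlockAveragingZd (offZ avgIterZ)
open B7SectCDGaugeAveragesRec (savgZ R0avgZ uavgZ)
open B7SectEFLinearisationRec (vtilGZ utilGZ utilGZ_zero utilGZ_succ rlamZ lamAvgGZ lamAvgGZ_zero lamAvgGZ_succ)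
open B7Eq84ConcreteRec (savgZ_congr)
open B8Ineq130Rec (tlo thi tlo_zero thi_zero block_mem smul_mem)
open B8Ineq172ConcreteRec (hol_block_congr uavgZ_congr_tower)

-- `Site` alone could resolve to the torus sites of `Setup.lean`; re-export the `ℤ^d` sites of `B7Prop1Explicit`.
export B7Prop1Explicit (Site)

variable {d : ℕ}

/-! ## §1 Locality of `ũ′ᵐ` (178)∕(179) and of `Q′_m` (211)–(213) of [3] on the CENTRED block tower -/
section Congr

variable {𝔸 : Type*} [NormedRing 𝔸] [NormedAlgebra ℂ 𝔸] [CompleteSpace 𝔸]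
variable {L s : ℕ} {j : ℕ} {y : Site d} {U₀ U₀' : Site d → Fin d → 𝔸ˣ}

/-- Locality of the centred twisted site average (78) on the tower (twin of `R0avg_congr_tower`): for site functions `v`, `v′` equal on the level-`m` sites of `B^{n+1}(y)`
(`n + (m+1) = j`) and backgrounds agreeing on the fine block, `(\overline{R₀v})(Lz) = (\overline{R₀v′})(Lz)` at the background `Ū₀ᵐ`, for every level-`(m+1)` site `z` of `Bⁿ(y)`.
[cite: Balaban1985Averaging, (78) p.30, p.24; Balaban1987RG1, (0.3) p.252] -/
theorem R0avgZ_congr_tower (hL : L = 2 * s + 1) (h₀ : AgreeOn (tlo L y j) (thi L y j) U₀ U₀') {m n : ℕ} (hmn : n + (m + 1) = j)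
    {v v' : Site d → 𝔸ˣ} (hv : ∀ x : Site d, tlo L y (n + 1) ≤ x → x ≤ thi L y (n + 1) → v x = v' x)
    {z : Site d} (hz : tlo L y n ≤ z) (hz' : z ≤ thi L y n) :
    R0avgZ L (avgIterZ L U₀ m) v ((L : ℤ) • z) = R0avgZ L (avgIterZ L U₀' m) v' ((L : ℤ) • z) := by
  obtain ⟨h1, h2⟩ := smul_mem hz hz'
  rw [R0avgZ, R0avgZ]
  refine savgZ_congr L ?_ fun r => ?_
  · rw [R0fun_self, R0fun_self, hv _ h1 h2]
  · obtain ⟨h3, h4⟩ := block_mem hL hz hz' r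
    simp only [R0fun_apply, add_sub_cancel_left]
    rw [hol_block_congr hL h₀ hmn hz hz' r, hv _ h3 h4]

/-- **Locality of `ũ′ᵐ` (178)∕(179), record structure** (`utilGZ`; twin of `utilG_congr_tower`) on the centred tower. [cite: Balaban1985Averaging, (178)–(179) p.45, p.24] -/
theorem utilGZ_congr_tower (hL : L = 2 * s + 1) (h₀ : AgreeOn (tlo L y j) (thi L y j) U₀ U₀') {u' u'' u₁ u₁' : Site d → 𝔸ˣ}
    (hu' : ∀ x : Site d, tlo L y j ≤ x → x ≤ thi L y j → u' x = u'' x)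
    (hu₁ : ∀ x : Site d, tlo L y j ≤ x → x ≤ thi L y j → u₁ x = u₁' x) :
    ∀ (m n : ℕ), n + m = j → ∀ z : Site d, tlo L y n ≤ z → z ≤ thi L y n →
      utilGZ L U₀ u' u₁ m z = utilGZ L U₀' u'' u₁' m z
  | 0, n, hn, z, hz, hz' => by
    have hnj : n = j := by omega
    subst hnj
    rw [utilGZ_zero, utilGZ_zero, hu' z hz hz']
  | m + 1, n, hmn, z, hz, hz' => by
    rw [utilGZ_succ, utilGZ_succ]
    simp only [vtilGZ]
    have hu1 : ∀ x : Site d, tlo L y (n + 1) ≤ x → x ≤ thi L y (n + 1) → uavgZ L U₀ u₁ m x = uavgZ L U₀' u₁' m x :=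
      fun x hx hx' => uavgZ_congr_tower hL h₀ hu₁ m (n + 1) (by omega) x hx hx'
    have hprod : ∀ x : Site d, tlo L y (n + 1) ≤ x → x ≤ thi L y (n + 1) →
        (utilGZ L U₀ u' u₁ m * uavgZ L U₀ u₁ m) x = (utilGZ L U₀' u'' u₁' m * uavgZ L U₀' u₁' m) x := fun x hx hx' => by
      rw [Pi.mul_apply, Pi.mul_apply, utilGZ_congr_tower hL h₀ hu' hu₁ m (n + 1) (by omega) x hx hx', hu1 x hx hx']
    rw [R0avgZ_congr_tower hL h₀ hmn hprod hz hz', R0avgZ_congr_tower hL h₀ hmn hu1 hz hz']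

/-- **Locality of the linear averaging `Q′_m` (211)–(213), record structure** (`lamAvgGZ`; twin of `lamAvgG_congr_tower`) on the centred tower.
[cite: Balaban1985Averaging, (211)–(213) p.50, p.24] -/
theorem lamAvgGZ_congr_tower (hL : L = 2 * s + 1) (h₀ : AgreeOn (tlo L y j) (thi L y j) U₀ U₀') {lam lam' : Site d → 𝔸}
    (hlam : ∀ x : Site d, tlo L y j ≤ x → x ≤ thi L y j → lam x = lam' x) :
    ∀ (m n : ℕ), n + m = j → ∀ z : Site d, tlo L y n ≤ z → z ≤ thi L y n →
      lamAvgGZ L U₀ m lam z = lamAvgGZ L U₀' m lam' z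
  | 0, n, hn, z, hz, hz' => by
    have hnj : n = j := by omega
    subst hnj
    rw [lamAvgGZ_zero, lamAvgGZ_zero, hlam z hz hz']
  | m + 1, n, hmn, z, hz, hz' => by
    rw [lamAvgGZ_succ, lamAvgGZ_succ]
    simp only [rlamZ, bmean_apply]
    refine Finset.sum_congr rfl fun r _ => ?_
    obtain ⟨h3, h4⟩ := block_mem hL hz hz' r
    rw [hol_block_congr hL h₀ hmn hz hz' r, lamAvgGZ_congr_tower hL h₀ hlam m (n + 1) (by omega) _ h3 h4]

end Congr

end Literature.MathematicalPhysics.QuantumFieldTheory.Balaban1983to89.B8Eq1115ConcreteRec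

end
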